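import Summits.Ventures.HodgeRepro.Primitive

/-!
# CM types on a `G`-set and the rank of an induced CM type

Blind re-derivation cell `pub-hodge-repro`, seat `typer` (gen 2).  Continues `CMRank.lean` /
`Primitive.lean`.

The embeddings of a (not necessarily Galois) CM field `K₁` with Galois closure `K`, `G = Gal(K/ℚ)`,
`H = Gal(K/K₁)`, form the `G`-set `G ⧸ H` of left cosets (the "`(G, H, S)` model").  A CM type
`Φ₁ ⊆ G ⧸ H` of `K₁` lifts to the CM type `Φ = π⁻¹(Φ₁) ⊆ G` of `K` (a union of left cosets, i.e.
`H ≤ rstab Φ`, `Primitive.lean`), and the rank is unchanged: the rows `ind (g • Φ)` of the type matrix of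
`Φ` are the rows of the type matrix of `Φ₁` with each column `x H` repeated `|H|` times.

* `typeMatrixOn Φ : Matrix G X ℚ`, `cmRankOn Φ` — the type matrix / rank of a subset of a `G`-set `X`
  (for `X = G` this is `typeMatrix` / `cmRank`);
* `cmRankOn_preimage` — the rank is unchanged under pull-back along an equivariant surjection;
* `cmRank_eq_cmRankOn_image_of_isInducedFrom` — the rank of a type induced from `K^H` is the rank of
  its image in `G ⧸ H`;
* `rank_submatrix_id_of_surjective` — the matrix tool: repeating columns does not change the rank.
-/

open Finset Matrix
open scoped Pointwise

namespace HodgeRepro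

/-! ### Repeating columns does not change the rank -/

section MatrixTool

variable {m n n' : Type*} [Fintype n] [Fintype n']

/-- Repeating (and permuting) the columns of a matrix along a surjection `π : n' → n` does not change the
rank. -/
theorem rank_submatrix_id_of_surjective (A : Matrix m n ℚ) (π : n' → n) (hπ : Function.Surjective π) :
    (A.submatrix id π).rank = A.rank := by
  refine le_antisymm (Matrix.rank_submatrix_le A id π) ?_
  obtain ⟨s, hs⟩ := hπ.hasRightInverse
  have h : A = (A.submatrix id π).submatrix id s := by
    ext i j
    simp only [Matrix.submatrix_apply, id_eq, hs j]
  conv_lhs => rw [h]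
  exact Matrix.rank_submatrix_le _ id s

end MatrixTool

/-! ### Pull-backs of subsets -/

section Preimage

variable {X Y : Type*} [Fintype X] [DecidableEq Y]

/-- The pull-back of a subset along a map `π : X → Y`. -/
def preimageSet (π : X → Y) (Φ : Finset Y) : Finset X := univ.filter fun x => π x ∈ Φ

/-- Membership in a pull-back. -/
@[simp] theorem mem_preimageSet (π : X → Y) (Φ : Finset Y) (x : X) :
    x ∈ preimageSet π Φ ↔ π x ∈ Φ := by
  simp [preimageSet]

end Preimage

/-! ### Type matrices on a `G`-set -/

variable (G : Type*) [Group G] [Fintype G] [DecidableEq G]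

section GSet

variable {X : Type*} [Fintype X] [DecidableEq X] [MulAction G X]

/-- The type matrix of a subset `Φ` of a `G`-set `X`: row `g` is the indicator of `g • Φ`. -/
def typeMatrixOn (Φ : Finset X) : Matrix G X ℚ := fun g x => if x ∈ g • Φ then 1 else 0

omit [Fintype G] [DecidableEq G] [Fintype X] in
/-- Entry `(g, x)` of the type matrix on a `G`-set: `1` iff `x ∈ g • Φ`. -/
@[simp] theorem typeMatrixOn_apply (Φ : Finset X) (g : G) (x : X) :
    typeMatrixOn G Φ g x = if x ∈ g • Φ then 1 else 0 := rfl

/-- The rank of a subset of a `G`-set (for `X = G`: `cmRank`). -/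
noncomputable def cmRankOn (Φ : Finset X) : ℕ := (typeMatrixOn G Φ).rank

end GSet

variable {G}

omit [Fintype G] in
/-- On `X = G` (left multiplication) the new notions are the old ones. -/
theorem typeMatrixOn_eq_typeMatrix (Φ : Finset G) : typeMatrixOn G Φ = typeMatrix Φ := rfl

/-- On `X = G` the rank on the `G`-set is `cmRank`. -/
theorem cmRankOn_eq_cmRank (Φ : Finset G) : cmRankOn G Φ = cmRank Φ := rfl

variable {X : Type*} [Fintype X] [DecidableEq X] [MulAction G X]
variable {Y : Type*} [Fintype Y] [DecidableEq Y] [MulAction G Y]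

omit [Fintype G] [DecidableEq G] [Fintype Y] in
/-- Translates of a pull-back along an equivariant map are pull-backs of translates. -/
theorem smul_preimageSet (π : X → Y) (hπ : ∀ (g : G) (x : X), π (g • x) = g • π x) (g : G)
    (Φ : Finset Y) : g • preimageSet π Φ = preimageSet π (g • Φ) := by
  ext x
  rw [← inv_smul_mem_iff, mem_preimageSet, mem_preimageSet, ← inv_smul_mem_iff, hπ]

omit [Fintype G] [DecidableEq G] [Fintype Y] in
/-- The type matrix of a pull-back is the type matrix of the original with the columns repeated
along `π`. -/
theorem typeMatrixOn_preimageSet (π : X → Y) (hπ : ∀ (g : G) (x : X), π (g • x) = g • π x)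
    (Φ : Finset Y) : typeMatrixOn G (preimageSet π Φ) = (typeMatrixOn G Φ).submatrix id π := by
  ext g x
  simp only [typeMatrixOn_apply, Matrix.submatrix_apply, id_eq, smul_preimageSet π hπ,
    mem_preimageSet]

omit [Fintype G] [DecidableEq G] in
/-- The rank is unchanged under pull-back along an equivariant surjection. -/
theorem cmRankOn_preimageSet (π : X → Y) (hπ : ∀ (g : G) (x : X), π (g • x) = g • π x)
    (hs : Function.Surjective π) (Φ : Finset Y) : cmRankOn G (preimageSet π Φ) = cmRankOn G Φ := by
  unfold cmRankOn
  rw [typeMatrixOn_preimageSet π hπ, rank_submatrix_id_of_surjective _ π hs]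

/-! ### Induced CM types: `Φ = π⁻¹(π Φ)` for `H ≤ rstab Φ` -/

section Induced

variable (H : Subgroup G) [DecidableEq (G ⧸ H)]

omit [DecidableEq G] in
/-- A subset stable under right multiplication by `H` is the pull-back of its image in `G ⧸ H`. -/
theorem eq_preimageSet_image_of_isInducedFrom {Φ : Finset G} (hΦ : IsInducedFrom Φ H) :
    Φ = preimageSet (QuotientGroup.mk : G → G ⧸ H) (Φ.image QuotientGroup.mk) := by
  ext x
  rw [mem_preimageSet, Finset.mem_image]
  constructor
  · intro hx; exact ⟨x, hx, rfl⟩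
  · rintro ⟨y, hy, hxy⟩
    have h : y⁻¹ * x ∈ H := QuotientGroup.eq.1 hxy
    have hst : rmul Φ (y⁻¹ * x) = Φ := hΦ h
    rw [← hst, mem_rmul, _root_.mul_inv_rev, inv_inv, ← mul_assoc, mul_inv_cancel, one_mul]
    exact hy

/-- The rank of a CM type induced from the subfield `K^H` is the rank of its image in `G ⧸ H`
(the type of the subfield in the `(G, H, S)` model). -/
theorem cmRank_eq_cmRankOn_image_of_isInducedFrom [Fintype (G ⧸ H)] {Φ : Finset G}
    (hΦ : IsInducedFrom Φ H) : cmRank Φ = cmRankOn G (Φ.image (QuotientGroup.mk : G → G ⧸ H)) := by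
  rw [← cmRankOn_eq_cmRank]
  conv_lhs => rw [eq_preimageSet_image_of_isInducedFrom H hΦ]
  exact cmRankOn_preimageSet (QuotientGroup.mk : G → G ⧸ H) (fun g x => rfl)
    QuotientGroup.mk_surjective _

end Induced

end HodgeRepro
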